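import Summits.Ventures.PercRepro.Night2FatDegSide

/-!
# night-2: the singly degenerate regime — the UNLOADED families

From the side-point dichotomy (`loaded_target_side_dichotomy_deg`):
* **`dload_eq_zero_of_side_free_deg`**: a target `T ∋ x` whose `Y` contains a side point `y₃` and a point `f ∉ clF M`
  lying on no class basis line coplanar with `M` is unloaded;
* **`dload_eq_zero_of_two_side_points_deg`** / **`…_of_two_side_points_deg'`**: a target whose `Y` contains two side
  points is unloaded as soon as `Y` has a point off `clF M`, or the line of `M` is not a non-class basis line;
* **`dload_eq_zero_of_singleton_of_class`** (no regime hypothesis): the level-2 target `Q ∪ {x, y}` of a point `y` lying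
  on no NON-class basis line is unloaded (a distance-1 line at level 2 is `{y, a, b}`; a distance-2 line has `≥ 3` points).
Paper `proofs/NIGHT-2-g35.md` §1.
-/

namespace PercRepro.Shadow

open PercRepro.ThmH PercRepro.PerFlat

variable {α : Type*} [DecidableEq α] {M : Matroid α} [M.Finite] {G : Finset α}

/-- **A side point and a free point make a target unloaded** (singly degenerate regime). -/
theorem dload_eq_zero_of_side_free_deg (hG : G ∈ flatsQ M (5 + 1)) (hd : (gr M \ G).card = 2)
    (hk : kColoops M G = 1) (hs : ∀ e ∈ gr M, ∀ f ∈ gr M, e ≠ f → rkN M {e, f} = 2)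
    (hl : ∀ e ∈ gr M, M.Indep {e}) (hfat : (fatClosures M 5 G 2).card ≤ 1) {B₀ : Finset α}
    (hB₀ : B₀ ∈ thinMembers M 5 G) {w₀ x : α} (hD : G \ clF M B₀ = {w₀, x}) (hne : w₀ ≠ x) {R₁ : Finset α}
    (hR₁V : R₁ ⊆ (G \ coloops M G) \ {w₀, x}) (hR₁2 : rkN M R₁ = 2) (hR₁3 : 3 ≤ R₁.card) {c₂ c₃ : α}
    (hc₂V : c₂ ∈ (G \ coloops M G) \ {w₀, x}) (hc₃V : c₃ ∈ (G \ coloops M G) \ {w₀, x})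
    (hc₂ : c₂ ∉ clF M R₁) (hc₃ : c₃ ∉ clF M (insert c₂ R₁))
    (hcover : ∀ e ∈ (G \ coloops M G) \ {w₀, x}, e ∈ clF M (insert c₂ R₁) ∨ e ∈ clF M (insert c₃ R₁))
    (hnd₂ : 3 ≤ rkN M (((G \ coloops M G) \ {w₀, x}).filter
      (fun e => e ∈ clF M (insert c₂ R₁) ∧ e ∉ clF M R₁)))
    {B : Finset α} (hB : B ∈ thinMembers M 5 G) (hnP : ¬ bigP M G B) {z : α} (hz : z ∈ G \ clF M B)
    (hw₀ : w₀ ∈ insert z B) (hxQ : x ∉ insert z B) {T : Finset α} (hT : T ∈ tgtSets M 5 G B z) (hxT : x ∈ T)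
    {y₃ : α} (hy₃ : y₃ ∈ (T \ insert z B).erase x) (hy₃3 : y₃ ∈ clF M (insert c₃ R₁)) (hy₃L : y₃ ∉ clF M R₁)
    {f : α} (hfY : f ∈ (T \ insert z B).erase x)
    (hf : f ∉ clF M (((G \ coloops M G) \ {w₀, x}).filter
      (fun e => e ∈ clF M (insert c₃ R₁) ∧ e ∉ clF M R₁)))
    (hf' : ∀ a ∈ (insert z B \ coloops M G).erase w₀, ∀ b ∈ (insert z B \ coloops M G).erase w₀, a ≠ b →
      f ∈ clF M {a, b} → rkN M (insert w₀ (insert x {a, b})) ≤ 3 →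
      4 ≤ rkN M ({a, b} ∪ ((G \ coloops M G) \ {w₀, x}).filter
        (fun e => e ∈ clF M (insert c₃ R₁) ∧ e ∉ clF M R₁))) :
    dload M 5 G (bigP M G) (dshGT2 M 5 G) T = 0 := by
  by_contra hload
  have hGg : G ⊆ gr M := (mem_flatsQ.1 hG).1
  have hTG : T ⊆ G := subset_G_of_mem_shadowAt (mem_tgtSets.1 hT).1
  have hd' : (gr M \ G).card ≤ 5 := by omega
  have hVg : (G \ coloops M G) \ {w₀, x} ⊆ gr M := fun e he =>
    hGg (Finset.mem_sdiff.1 (Finset.mem_sdiff.1 he).1).1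
  have hMg : ((G \ coloops M G) \ {w₀, x}).filter (fun e => e ∈ clF M (insert c₃ R₁) ∧ e ∉ clF M R₁) ⊆ gr M :=
    (Finset.filter_subset _ _).trans hVg
  -- `y₃` is a side point, hence `f ≠ y₃`
  have hy₃x : y₃ ≠ x := (Finset.mem_erase.1 hy₃).1
  have hy₃TQ : y₃ ∈ T \ insert z B := Finset.mem_of_mem_erase hy₃
  have hy₃Q : y₃ ∉ insert z B := (Finset.mem_sdiff.1 hy₃TQ).2
  have hKQ : coloops M G ⊆ insert z B :=
    (coloops_subset_of_mem_thinMembers hG hd' hB).trans (Finset.subset_insert _ _)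
  have hy₃V : y₃ ∈ (G \ coloops M G) \ {w₀, x} := by
    rw [Finset.mem_sdiff, Finset.mem_sdiff, Finset.mem_insert, Finset.mem_singleton]
    refine ⟨⟨hTG (Finset.mem_sdiff.1 hy₃TQ).1, fun h => hy₃Q (hKQ h)⟩, ?_⟩
    rintro (rfl | rfl)
    · exact hy₃Q hw₀
    · exact hy₃x rfl
  have hy₃M : y₃ ∈ ((G \ coloops M G) \ {w₀, x}).filter
      (fun e => e ∈ clF M (insert c₃ R₁) ∧ e ∉ clF M R₁) := Finset.mem_filter.2 ⟨hy₃V, hy₃3, hy₃L⟩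
  have hfy : f ≠ y₃ := by
    rintro rfl
    exact hf (subset_clF_of_subset_gr hMg hy₃M)
  rcases loaded_target_side_dichotomy_deg hG hd hk hs hl hfat hB₀ hD hne hR₁V hR₁2 hR₁3 hc₂V hc₃V hc₂ hc₃ hcover
      hnd₂ hB hnP hz hw₀ hxQ hT hxT hy₃ hy₃3 hy₃L hload with
    ⟨a, ha, b, hb, hab, hcls, hcop, hYab, -⟩ | ⟨hYM, -, -, -⟩
  · have hfab : f ∈ clF M {a, b} := hYab (Finset.mem_erase.2 ⟨hfy, hfY⟩)
    have := hf' a ha b hb hab hfab hcls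
    omega
  · exact hf (hYM hfY)

/-- **Two side points and a point off `clF M` make a target unloaded** (singly degenerate regime). -/
theorem dload_eq_zero_of_two_side_points_deg (hG : G ∈ flatsQ M (5 + 1)) (hd : (gr M \ G).card = 2)
    (hk : kColoops M G = 1) (hs : ∀ e ∈ gr M, ∀ f ∈ gr M, e ≠ f → rkN M {e, f} = 2)
    (hl : ∀ e ∈ gr M, M.Indep {e}) (hfat : (fatClosures M 5 G 2).card ≤ 1) {B₀ : Finset α}
    (hB₀ : B₀ ∈ thinMembers M 5 G) {w₀ x : α} (hD : G \ clF M B₀ = {w₀, x}) (hne : w₀ ≠ x) {R₁ : Finset α}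
    (hR₁V : R₁ ⊆ (G \ coloops M G) \ {w₀, x}) (hR₁2 : rkN M R₁ = 2) (hR₁3 : 3 ≤ R₁.card) {c₂ c₃ : α}
    (hc₂V : c₂ ∈ (G \ coloops M G) \ {w₀, x}) (hc₃V : c₃ ∈ (G \ coloops M G) \ {w₀, x})
    (hc₂ : c₂ ∉ clF M R₁) (hc₃ : c₃ ∉ clF M (insert c₂ R₁))
    (hcover : ∀ e ∈ (G \ coloops M G) \ {w₀, x}, e ∈ clF M (insert c₂ R₁) ∨ e ∈ clF M (insert c₃ R₁))
    (hnd₂ : 3 ≤ rkN M (((G \ coloops M G) \ {w₀, x}).filter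
      (fun e => e ∈ clF M (insert c₂ R₁) ∧ e ∉ clF M R₁)))
    {B : Finset α} (hB : B ∈ thinMembers M 5 G) (hnP : ¬ bigP M G B) {z : α} (hz : z ∈ G \ clF M B)
    (hw₀ : w₀ ∈ insert z B) (hxQ : x ∉ insert z B) {T : Finset α} (hT : T ∈ tgtSets M 5 G B z) (hxT : x ∈ T)
    {y₃ y₃' : α} (hy₃ : y₃ ∈ (T \ insert z B).erase x) (hy₃3 : y₃ ∈ clF M (insert c₃ R₁)) (hy₃L : y₃ ∉ clF M R₁)
    (hy₃' : y₃' ∈ (T \ insert z B).erase x) (hy₃'3 : y₃' ∈ clF M (insert c₃ R₁)) (hy₃'L : y₃' ∉ clF M R₁)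
    (hne₃ : y₃ ≠ y₃') {f : α} (hfY : f ∈ (T \ insert z B).erase x)
    (hf : f ∉ clF M (((G \ coloops M G) \ {w₀, x}).filter
      (fun e => e ∈ clF M (insert c₃ R₁) ∧ e ∉ clF M R₁))) :
    dload M 5 G (bigP M G) (dshGT2 M 5 G) T = 0 := by
  by_contra hload
  rcases loaded_target_side_dichotomy_deg hG hd hk hs hl hfat hB₀ hD hne hR₁V hR₁2 hR₁3 hc₂V hc₃V hc₂ hc₃ hcover
      hnd₂ hB hnP hz hw₀ hxQ hT hxT hy₃ hy₃3 hy₃L hload with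
    ⟨a, ha, b, hb, hab, hcls, hcop, hYab, hno⟩ | ⟨hYM, -, -, -⟩
  · exact hno y₃' (Finset.mem_erase.2 ⟨hne₃.symm, hy₃'⟩) ⟨hy₃'3, hy₃'L⟩
  · exact hf (hYM hfY)

/-- **Two side points make a target unloaded when the line of `M` is not a non-class basis line** (singly
degenerate regime). -/
theorem dload_eq_zero_of_two_side_points_deg' (hG : G ∈ flatsQ M (5 + 1)) (hd : (gr M \ G).card = 2)
    (hk : kColoops M G = 1) (hs : ∀ e ∈ gr M, ∀ f ∈ gr M, e ≠ f → rkN M {e, f} = 2)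
    (hl : ∀ e ∈ gr M, M.Indep {e}) (hfat : (fatClosures M 5 G 2).card ≤ 1) {B₀ : Finset α}
    (hB₀ : B₀ ∈ thinMembers M 5 G) {w₀ x : α} (hD : G \ clF M B₀ = {w₀, x}) (hne : w₀ ≠ x) {R₁ : Finset α}
    (hR₁V : R₁ ⊆ (G \ coloops M G) \ {w₀, x}) (hR₁2 : rkN M R₁ = 2) (hR₁3 : 3 ≤ R₁.card) {c₂ c₃ : α}
    (hc₂V : c₂ ∈ (G \ coloops M G) \ {w₀, x}) (hc₃V : c₃ ∈ (G \ coloops M G) \ {w₀, x})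
    (hc₂ : c₂ ∉ clF M R₁) (hc₃ : c₃ ∉ clF M (insert c₂ R₁))
    (hcover : ∀ e ∈ (G \ coloops M G) \ {w₀, x}, e ∈ clF M (insert c₂ R₁) ∨ e ∈ clF M (insert c₃ R₁))
    (hnd₂ : 3 ≤ rkN M (((G \ coloops M G) \ {w₀, x}).filter
      (fun e => e ∈ clF M (insert c₂ R₁) ∧ e ∉ clF M R₁)))
    {B : Finset α} (hB : B ∈ thinMembers M 5 G) (hnP : ¬ bigP M G B) {z : α} (hz : z ∈ G \ clF M B)
    (hw₀ : w₀ ∈ insert z B) (hxQ : x ∉ insert z B)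
    (hM : ¬ (4 ≤ rkN M (insert w₀ (insert x (((G \ coloops M G) \ {w₀, x}).filter
        (fun e => e ∈ clF M (insert c₃ R₁) ∧ e ∉ clF M R₁)))) ∧
      ∃ a ∈ (insert z B \ coloops M G).erase w₀, ∃ b ∈ (insert z B \ coloops M G).erase w₀, a ≠ b ∧
        a ∈ clF M (((G \ coloops M G) \ {w₀, x}).filter
          (fun e => e ∈ clF M (insert c₃ R₁) ∧ e ∉ clF M R₁)) ∧
        b ∈ clF M (((G \ coloops M G) \ {w₀, x}).filter
          (fun e => e ∈ clF M (insert c₃ R₁) ∧ e ∉ clF M R₁))))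
    {T : Finset α} (hT : T ∈ tgtSets M 5 G B z) (hxT : x ∈ T)
    {y₃ y₃' : α} (hy₃ : y₃ ∈ (T \ insert z B).erase x) (hy₃3 : y₃ ∈ clF M (insert c₃ R₁)) (hy₃L : y₃ ∉ clF M R₁)
    (hy₃' : y₃' ∈ (T \ insert z B).erase x) (hy₃'3 : y₃' ∈ clF M (insert c₃ R₁)) (hy₃'L : y₃' ∉ clF M R₁)
    (hne₃ : y₃ ≠ y₃') :
    dload M 5 G (bigP M G) (dshGT2 M 5 G) T = 0 := by
  by_contra hload
  rcases loaded_target_side_dichotomy_deg hG hd hk hs hl hfat hB₀ hD hne hR₁V hR₁2 hR₁3 hc₂V hc₃V hc₂ hc₃ hcover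
      hnd₂ hB hnP hz hw₀ hxQ hT hxT hy₃ hy₃3 hy₃L hload with
    ⟨a, ha, b, hb, hab, hcls, hcop, hYab, hno⟩ | ⟨-, hncls, hab, -⟩
  · exact hno y₃' (Finset.mem_erase.2 ⟨hne₃.symm, hy₃'⟩) ⟨hy₃'3, hy₃'L⟩
  · exact hM ⟨hncls, hab⟩

/-- **The level-2 target of a point on no non-class basis line is unloaded** (no regime hypothesis): a distance-1
line at level `2` is `{y, a, b}` for two basis points `a, b`, and it is not a class line; a distance-2 line at
level `2` would have two points. -/
theorem dload_eq_zero_of_singleton_of_class (hG : G ∈ flatsQ M (5 + 1)) (hd : (gr M \ G).card = 2)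
    (hk : kColoops M G = 1) (hs : ∀ e ∈ gr M, ∀ f ∈ gr M, e ≠ f → rkN M {e, f} = 2)
    (hl : ∀ e ∈ gr M, M.Indep {e}) (hfat : (fatClosures M 5 G 2).card ≤ 1) {B₀ : Finset α}
    (hB₀ : B₀ ∈ thinMembers M 5 G) {w₀ x : α} (hD : G \ clF M B₀ = {w₀, x}) (hne : w₀ ≠ x)
    {B : Finset α} (hB : B ∈ thinMembers M 5 G) (hnP : ¬ bigP M G B) {z : α} (hz : z ∈ G \ clF M B)
    (hw₀ : w₀ ∈ insert z B) (hxQ : x ∉ insert z B) {T : Finset α} (hT : T ∈ tgtSets M 5 G B z) (hxT : x ∈ T)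
    (hT2 : (T \ insert z B).card = 2) {y : α} (hy : y ∈ (T \ insert z B).erase x)
    (hcls : ∀ a ∈ (insert z B \ coloops M G).erase w₀, ∀ b ∈ (insert z B \ coloops M G).erase w₀, a ≠ b →
      y ∈ clF M {a, b} → rkN M (insert w₀ (insert x {a, b})) ≤ 3) :
    dload M 5 G (bigP M G) (dshGT2 M 5 G) T = 0 := by
  by_contra hload
  have hGg : G ⊆ gr M := (mem_flatsQ.1 hG).1
  have hTG : T ⊆ G := subset_G_of_mem_shadowAt (mem_tgtSets.1 hT).1
  have hQT : insert z B ⊆ T := (mem_tgtSets.1 hT).2.1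
  have hw₀T : w₀ ∈ T := hQT hw₀
  have hlev := card_sdiff_coloops_eq_level_add_five hG hd hk hB hnP hz hT
  obtain ⟨R, hR, hR2, hR3, hcase⟩ :=
    loaded_fat_target_dichotomy_full hG hd hk hs hl hfat hB₀ hD hne hTG hw₀T hxT hload
  have hRg : R ⊆ gr M := fun r hr => hGg (hTG (Finset.mem_sdiff.1 (Finset.mem_sdiff.1 (hR hr)).1).1)
  have hRP₀ : ∀ r ∈ R, r ∈ insert z B → r ∈ (insert z B \ coloops M G).erase w₀ := by
    intro r hr hrQ
    have h1 := Finset.mem_sdiff.1 (hR hr)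
    rw [Finset.mem_insert, Finset.mem_singleton, not_or] at h1
    exact Finset.mem_erase.2 ⟨h1.2.1, Finset.mem_sdiff.2 ⟨hrQ, (Finset.mem_sdiff.1 h1.1).2⟩⟩
  rcases hcase with ⟨hRc, -, hRncls⟩ | ⟨hRc, -, -⟩
  · obtain ⟨hYR, hRQ2⟩ := sdiff_subset_line_of_dist_one_fat hG hd hk hB hnP hz hT hxT hxQ hR hR2 hRc
    obtain ⟨a, ha, b, hb, hab⟩ := Finset.one_lt_card.1 (by omega : 1 < (R ∩ insert z B).card)
    have haR : a ∈ R := (Finset.mem_inter.1 ha).1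
    have hbR : b ∈ R := (Finset.mem_inter.1 hb).1
    have habg : ({a, b} : Finset α) ⊆ gr M :=
      Finset.insert_subset (hRg haR) (Finset.singleton_subset_iff.2 (hRg hbR))
    have hRab : R ⊆ clF M {a, b} :=
      subset_clF_of_rkN_le_two_of_two_mem hs hRg hR2.le haR hbR hab
        (subset_clF_of_subset_gr habg (Finset.mem_insert_self _ _))
        (subset_clF_of_subset_gr habg (Finset.mem_insert_of_mem (Finset.mem_singleton_self _)))
    have hyab : y ∈ clF M {a, b} := hRab (hYR hy)
    have hcls' := hcls a (hRP₀ a haR (Finset.mem_inter.1 ha).2) b (hRP₀ b hbR (Finset.mem_inter.1 hb).2) hab hyab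
    -- `R ∪ {w₀, x} ⊆ clF ({a, b} ∪ {w₀, x})`
    have hw₀g : w₀ ∈ gr M := by
      have : w₀ ∈ G \ clF M B₀ := by rw [hD]; exact Finset.mem_insert_self _ _
      exact hGg (Finset.mem_sdiff.1 this).1
    have hxg : x ∈ gr M := by
      have : x ∈ G \ clF M B₀ := by rw [hD]; exact Finset.mem_insert_of_mem (Finset.mem_singleton_self _)
      exact hGg (Finset.mem_sdiff.1 this).1
    have hXg : insert w₀ (insert x {a, b}) ⊆ gr M :=
      Finset.insert_subset hw₀g (Finset.insert_subset hxg habg)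
    have hsub : insert w₀ (insert x R) ⊆ clF M (insert w₀ (insert x {a, b})) := by
      intro e he
      rw [Finset.mem_insert, Finset.mem_insert] at he
      rcases he with rfl | rfl | he
      · exact subset_clF_of_subset_gr hXg (Finset.mem_insert_self _ _)
      · exact subset_clF_of_subset_gr hXg (Finset.mem_insert_of_mem (Finset.mem_insert_self _ _))
      · exact clF_mono ((Finset.subset_insert _ _).trans (Finset.subset_insert _ _)) (hRab he)
    have := rkN_mono (M := M) hsub
    rw [rkN_clF] at this
    omega
  · omega

end PercRepro.Shadow
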